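import Summits.QuantumFields.YangMills.Theorems.BalabanUVNodesN07SplitClauseOfRecordShear
import Summits.QuantumFields.YangMills.Theorems.BalabanUVNodesN07Letters10NearTopDoors
import HarnessLib

/-!
# N07 [B11] (= [15] = [Balaban1985Variational]) Sect. F, road of record R0′, S6 HEAD — **THE OUTWARD MEET EDITION, FILE B: ROW (r2)'s RECORD DOOR ON A WINDOW OF NEAR-TOP CELLS**
# (n07-e `OUTWARD-MEET-EDITION-SPEC.md` (E1); n07-w8 g6 «(E1) YOURS, GO», cell bus I.40320): the (r2) chain of dag-n07-w8 — `N07SplitClauseOfCoarseShift.…_outerDefect_adm22_T4` →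
# `N07SplitClauseOfShearSize.…_levLift_under_adm22_T4` → `N07SplitClauseOfRecordShear.…_recordShear_dominated_adm22_T4` — asks the window over the TOP domain `Ω_{K−n}` of the
# family; at an outward boundary datum the print box over print's (150) family `D″ = cubeDomains ⊓ domainsOfSeq s.Ω` carries cells of level `K − n − 1` too.  This file re-derives
# the three doors with `hY : ∀ x ∈ Y, D.InOm (K − n − 1) x`, every other binder and threshold VERBATIM, keyed on FILE A §6 `letters10On_extension_of_uniformDatum_adm22_T4_nearTop`
# (the factor `L⁴` and the second (2.60) layer ride in the existential constant `C`)

Cell `pub-ymgap`, width seat `pub-ymgap-dag-n07-w4` g5 (sub-target S6 = the HEAD; MODULE 57 default pen), CLAIM-1 path (1) ∕ INTENT-3 (cell bus).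
`--kind proof --supports stmt-QuantumFields-27364 --as helper` (K1⁹ per dag-lead KEY MAP v2); count-neutral; def-free.
[15] = [Balaban1985Variational]; [4] = [Balaban1984PropagatorsII]; [I.4] = [Balaban1984PropagatorsI]; [3] = [Balaban1985Averaging].

WHAT IS PROVED (sorry-free; no definition; axioms standard; all BY NAME, proofs = the parents' with the near-top root).
* ★★ `localGaugeSplitOn_of_gauge152_coarseShift_outerDefect_adm22_T4_nearTop F N` — FILE 6 (n07-w8) §2 on a window over `Ω_{K−n−1}` (∘ FILE A §6 + n07-w8's
  `norm_sub_bondAvgIter_grad_le_of_outerDefect_le` + `localGaugeSplitOn_of_gauge152_coarseShift_sub`).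
* ★★ `localGaugeSplitOn_of_gauge152_coarseShift_levLift_under_adm22_T4_nearTop F N` — n07-w8's SHARP door (family sized at and under the outer end-points) on a window over `Ω_{K−n−1}`.
* ★★★ `localGaugeSplitOn_of_gauge152_recordShear_dominated_adm22_T4_nearTop F N` — n07-w8's SIGN-FREE RECORD DOOR (family dominated by `‖log ĝ_j(y)⁻¹‖`, per-level boxes and letters
  `v_j, a_j`, uniform `σ`, the three box-membership facts, S3's gauge, the (159)-splitting) on a window over `Ω_{K−n−1}`: `LocalGaugeSplitOn Y η_{K−n} t (t₁ + (t₂ + t_∂) + t₃) U` for every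
  `t_∂ > 2CB₃·(4σ)` — the door (E3)'s FILE 2-meet instantiates at `D″`.
HONEST SCOPE.  Count-neutral re-derivations of n07-w8's three doors with one hypothesis weakened (no declaration of theirs touched); every displayed binder is a hypothesis; nothing of
[15]∕[4]∕[3] ANALYSIS asserted; `LocalLettersSplitTopStepCore(G∕R)` ∕ `DatumGaugeSplitTopStepCore(G∕R)` ∕ `HalvingStepTop(Core)` ∕ `stub_prop8StepCoPG13` NOT discharged; K0⁷ ∕ K1⁹
NOT closed; N07 NOT discharged; counts unmoved (typed 28∕28 · discharged 5∕27); one finite 𝕋⁴ programme at fixed ε — the route closes the conditional finite-𝕋⁴ rung `BalabanLadder.UV`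
ONLY; the YM mass gap (Clay) is NOT proved by any of this; nothing continuum ∕ ℝ⁴ ∕ OS.  No `sorry`, no `def`, no `instance`, no `notation`.

RELATED IN THE TREE, NOT DUPLICATED (stem check: `rg 'adm22_T4_nearTop' Theorems` = FILE A only): n07-w8's `N07SplitClauseOfCoarseShift` ∕ `N07SplitClauseOfShearSize` ∕
`N07SplitClauseOfRecordShear` (the top-window parents, CONSUMED BY NAME for every step but the root); FILE A `N07Letters10NearTopDoors` (the root).

References: [15] (144) p. 300, (150)–(152) p. 301, (157)–(159) pp. 302–303, (161) p. 303, (164)–(165) p. 304, (168) p. 304; [4] (2.1)–(2.4) p. 224, (2.35) p. 228, (2.60)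
p. 234, Cor. 2.8 (2.150)–(2.151) p. 249; [I.4] (1.18)–(1.20) p. 20; [3] (85)–(88) p. 31.
-/

set_option autoImplicit false

noncomputable section
open scoped BigOperators Matrix.Norms.L2Operator

namespace Summit.QuantumFields.YangMills.BalabanUVNodes.N07SplitClauseRecordShearNearTop

open Literature.MathematicalPhysics.QuantumFieldTheory.Balaban1983to89
open Literature.MathematicalPhysics.QuantumFieldTheory.Balaban1983to89.Node00
open Literature.MathematicalPhysics.QuantumFieldTheory.Balaban1983to89.B12RegularSpaces111 (gaugeU expI grad)
open LatticeFieldCalculus (siteAvgIter bondAvgIter)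
open B5Eq118OneStroke (iterBlockOf)
open B11Eq115Space (levOf)
open B6SectADomainsV1 (Domains)
open B6SectAOperatorsV1 (BondIdx)
open T4Continuum (T4Family)
open T4AxialGaugeSmallField (castSite)
open B16Sect1Backgrounds (toMS)
open GaugeField (gaugeAct)
open MatrixLog (mlog)
open Summit.QuantumFields.YangMills.Theorems.FlatCubeLevels (lamSite_levOf_inOm)
open Summit.QuantumFields.YangMills.Theorems.FlatCubeOpsText (Adm22)
open Summit.QuantumFields.YangMills.Theorems.K0FlatCubeOpsTextP (flatH IsLevWeight)
open Summit.QuantumFields.YangMills.BalabanUVNodes.N07HalvingStepTopOfLocalLetters (Letters10On)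
open Summit.QuantumFields.YangMills.BalabanUVNodes.N07LocalLettersSplitCore (LocalGaugeSplitOn)
open Summit.QuantumFields.YangMills.BalabanUVNodes.N07CoarseGaugeQForm (siteAvgIter_levLift)
open Summit.QuantumFields.YangMills.BalabanUVNodes.N07SplitClauseOfCoarseShift (norm_sub_bondAvgIter_grad_le_of_outerDefect_le localGaugeSplitOn_of_gauge152_coarseShift_sub)
open Summit.QuantumFields.YangMills.BalabanUVNodes.N07SplitClauseOfShearSize (outerDefect_levLift_le_of_norm_le_under norm_mlog_centredShear_inv_le_box_record
  iterBlockOf_levOf_mem_of_lamSite)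
open Summit.QuantumFields.YangMills.BalabanUVNodes.N07Letters10NearTopDoors (letters10On_extension_of_uniformDatum_adm22_T4_nearTop)

/-! ## §1  The coarse-shift clause with outer defect `≤ ς_∂`, window over `Ω_{K−n−1}` -/

open scoped Classical in
/-- ★★ **THE R0′ SPLIT CLAUSE AT NODE 00's OBJECTS FOR A COARSE FAMILY WITH OUTER DEFECT `≤ ς_∂`, WINDOW OF NEAR-TOP CELLS** — n07-w8's
`localGaugeSplitOn_of_gauge152_coarseShift_outerDefect_adm22_T4` with `∀ x ∈ Y, D.InOm (K − n − 1) x`, every other binder VERBATIM: `LocalGaugeSplitOn Y η_{K−n} t (t₁ + (t₂ + t_∂) + t₃) U`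
for every `t_∂ > 2CB₃ς_∂` (FILE A §6 for the defect's letters).
[cite: Balaban1985Variational, (150) p.301, (152) p.301, (157)–(159) pp.302–303, (161) p.303, (164)–(165) p.304, (168) p.304; Balaban1984PropagatorsII, (2.3) p.224, (2.35) p.228, (2.60) p.234, Cor. 2.8 (2.150)–(2.151) p.249; Balaban1984PropagatorsI, (1.20) p.20] -/
theorem localGaugeSplitOn_of_gauge152_coarseShift_outerDefect_adm22_T4_nearTop (F : T4Family) (N : ℕ) [NeZero N] :
    ∃ (Mh₀ R₀ : ℕ) (C δ₀ δ₁ B₃ : ℝ), 0 ≤ C ∧ 0 < δ₀ ∧ 0 < δ₁ ∧ 0 < B₃ ∧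
    ∀ (n K : ℕ) (_ : 1 ≤ K - n) (_ : K - n + 1 ≤ F.m + K) {Mh R a' : ℕ} (_ : Mh = F.L ^ a') (_ : Mh₀ ≤ Mh) (_ : R₀ ≤ R) (_ : a' + 3 ≤ F.m + n)
      (D : Domains (F.P K)) (_ : D.k = K - n) (_ : Adm22 D R (F.L * Mh))
      (w : ℕ → PBond (F.P K) 0 → ℝ) (_ : IsLevWeight (F.P K) (K - n) D w)
      {Y : Set (Site (F.P K) 0)} (_ : ∀ x ∈ Y, D.InOm (K - n - 1) x)
      {HV : (BondIdx D → MatA N) →ₗ[ℂ] (PBond (F.P K) 0 → MatA N)}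
      (_ : ∀ (B : BondIdx D → MatA N) (b : PBond (F.P K) 0), HV B b = ∑ c, ((flatH (F.P K) (K - n) D (Pi.single c 1) b : ℝ) : ℂ) • B c)
      {lam : (j : ℕ) → Site (F.P K) j → MatA N} {μ : Site (F.P K) 0 → MatA N}
      (_ : ∀ (j : ℕ) (y : Site (F.P K) j), D.LamSite j y → siteAvgIter j μ y = lam j y)
      {ςD : ℝ} (_ : 0 ≤ ςD)
      (_ : ∀ c : BondIdx D,
        (c.1.2.src ∉ D.Om c.1.1 → ‖lam c.1.1 c.1.2.src - siteAvgIter (c.1.1 : ℕ) μ c.1.2.src‖ ≤ ςD) ∧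
        (c.1.2.tgt ∉ D.Om c.1.1 → ‖lam c.1.1 c.1.2.tgt - siteAvgIter (c.1.1 : ℕ) μ c.1.2.tgt‖ ≤ ςD))
      {X : BondIdx D → MatA N}
      (_ : ∀ c : BondIdx D, X c = LatticeFieldCalculus.grad (((F.P K).L : ℝ) ^ (K - n) / ((F.P K).L : ℝ) ^ (c.1.1 : ℕ)) (lam c.1.1) c.1.2)
      {U : GaugeField (F.P K) 0 (SU N)} (u : GaugeTransf (F.P K) 0 (SU N)) {A A₁ A₂ A₃ : PBond (F.P K) 0 → MatA N} {t t₁ t₂ t₃ : ℝ}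
      (_ : ∀ b ∈ (Sect2.regionOfSet (F.P K) Y).bonds,
        gaugeU (fun x => ιSU N (u x)) (fun b' => ιSU N (U b')) b = expI ((F.P K).eta (K - n)) (A b))
      (_ : ∀ b ∈ (Sect2.regionOfSet (F.P K) Y).bonds, ‖A b‖ < t)
      (_ : ∀ q ∈ (Sect2.regionOfSet (F.P K) Y).dpairs, ‖grad ((F.P K).eta (K - n)) q.2.1 (fun y => A ⟨y, q.2.2⟩) q.1‖ < t)
      (_ : ∀ b, A b - HV X b = A₁ b + A₂ b - A₃ b)
      (_ : Letters10On Y ((F.P K).eta (K - n)) t₁ A₁) (_ : Letters10On Y ((F.P K).eta (K - n)) t₂ A₂) (_ : Letters10On Y ((F.P K).eta (K - n)) t₃ A₃)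
      {tD : ℝ} (_ : 2 * C * B₃ * ςD < tD),
      LocalGaugeSplitOn Y ((F.P K).eta (K - n)) t (t₁ + (t₂ + tD) + t₃) U := by
  obtain ⟨Mh₀, R₀, C, δ₀, δ₁, B₃, hC, hδ₀, hδ₁, hB₃, hmain⟩ := letters10On_extension_of_uniformDatum_adm22_T4_nearTop F N
  refine ⟨Mh₀, R₀, C, δ₀, δ₁, B₃, hC, hδ₀, hδ₁, hB₃, ?_⟩
  intro n K hk1 hk' Mh R a' hMha hMh hR hsize D hDk hAdm w hw Y hY HV hHV lam μ hμ ςD hς hout X hX U u A A₁ A₂ A₃ t t₁ t₂ t₃ he hA hdA h159 h₁ h₂ h₃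
    tD htD
  -- the defect datum has the level-uniform size `ς_∂·L^{(K−n)−j(c)}`
  have hXD : ∀ c : BondIdx D,
      ‖(fun c => X c - bondAvgIter (c.1.1 : ℕ) (LatticeFieldCalculus.grad (((F.P K).L : ℝ) ^ (K - n)) μ) c.1.2) c‖
        ≤ ςD * ((F.P K).L : ℝ) ^ ((K - n) - (c.1.1 : ℕ)) := fun c =>
    norm_sub_bondAvgIter_grad_le_of_outerDefect_le hμ hDk.le hX hς hout c
  have hDL : Letters10On Y ((F.P K).eta (K - n)) tD
      (HV (fun c => X c - bondAvgIter (c.1.1 : ℕ) (LatticeFieldCalculus.grad (((F.P K).L : ℝ) ^ (K - n)) μ) c.1.2)) :=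
    hmain n K hk1 hk' hMha hMh hR hsize D hDk hAdm w hw hY hHV hς hXD htD
  exact localGaugeSplitOn_of_gauge152_coarseShift_sub u hHV X μ he hA hdA h159 h₁ h₂ h₃ hDL

/-! ## §2  The sharp door (family sized at and under the outer end-points), window over `Ω_{K−n−1}` -/

open scoped Classical in
/-- ★★ **THE SHARP DOOR ON A WINDOW OF NEAR-TOP CELLS** — n07-w8's `localGaugeSplitOn_of_gauge152_coarseShift_levLift_under_adm22_T4` with `∀ x ∈ Y, D.InOm (K − n − 1) x`,
every other binder VERBATIM (§1 at `μ := μ_λ`, `ς_∂ := s + s`).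
[cite: Balaban1985Variational, (144) p.300, (152) p.301, (157)–(159) pp.302–303, (161) p.303, (164)–(165) p.304, (168) p.304; Balaban1984PropagatorsII, (2.1)–(2.4) p.224, (2.35) p.228, (2.60) p.234, Cor. 2.8 (2.150)–(2.151) p.249; Balaban1984PropagatorsI, (1.18)–(1.20) p.20] -/
theorem localGaugeSplitOn_of_gauge152_coarseShift_levLift_under_adm22_T4_nearTop (F : T4Family) (N : ℕ) [NeZero N] :
    ∃ (Mh₀ R₀ : ℕ) (C δ₀ δ₁ B₃ : ℝ), 0 ≤ C ∧ 0 < δ₀ ∧ 0 < δ₁ ∧ 0 < B₃ ∧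
    ∀ (n K : ℕ) (_ : 1 ≤ K - n) (_ : K - n + 1 ≤ F.m + K) {Mh R a' : ℕ} (_ : Mh = F.L ^ a') (_ : Mh₀ ≤ Mh) (_ : R₀ ≤ R) (_ : a' + 3 ≤ F.m + n)
      (D : Domains (F.P K)) (_ : D.k = K - n) (_ : Adm22 D R (F.L * Mh))
      (w : ℕ → PBond (F.P K) 0 → ℝ) (_ : IsLevWeight (F.P K) (K - n) D w)
      {Y : Set (Site (F.P K) 0)} (_ : ∀ x ∈ Y, D.InOm (K - n - 1) x)
      {HV : (BondIdx D → MatA N) →ₗ[ℂ] (PBond (F.P K) 0 → MatA N)}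
      (_ : ∀ (B : BondIdx D → MatA N) (b : PBond (F.P K) 0), HV B b = ∑ c, ((flatH (F.P K) (K - n) D (Pi.single c 1) b : ℝ) : ℂ) • B c)
      (lam : (j : ℕ) → Site (F.P K) j → MatA N) {s : ℝ} (_ : 0 ≤ s)
      (_ : ∀ c : BondIdx D, (c.1.2.src ∉ D.Om c.1.1 → ‖lam c.1.1 c.1.2.src‖ ≤ s) ∧ (c.1.2.tgt ∉ D.Om c.1.1 → ‖lam c.1.1 c.1.2.tgt‖ ≤ s))
      (_ : ∀ (c : BondIdx D) (x : Site (F.P K) 0),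
        (c.1.2.src ∉ D.Om c.1.1 ∧ iterBlockOf c.1.1 x = c.1.2.src) ∨ (c.1.2.tgt ∉ D.Om c.1.1 ∧ iterBlockOf c.1.1 x = c.1.2.tgt) →
        ‖lam (levOf (fun i => {z : Site (F.P K) 0 | D.InOm i z}) D.k x) (iterBlockOf (levOf (fun i => {z : Site (F.P K) 0 | D.InOm i z}) D.k x) x)‖ ≤ s)
      {X : BondIdx D → MatA N}
      (_ : ∀ c : BondIdx D, X c = LatticeFieldCalculus.grad (((F.P K).L : ℝ) ^ (K - n) / ((F.P K).L : ℝ) ^ (c.1.1 : ℕ)) (lam c.1.1) c.1.2)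
      {U : GaugeField (F.P K) 0 (SU N)} (u : GaugeTransf (F.P K) 0 (SU N)) {A A₁ A₂ A₃ : PBond (F.P K) 0 → MatA N} {t t₁ t₂ t₃ : ℝ}
      (_ : ∀ b ∈ (Sect2.regionOfSet (F.P K) Y).bonds,
        gaugeU (fun x => ιSU N (u x)) (fun b' => ιSU N (U b')) b = expI ((F.P K).eta (K - n)) (A b))
      (_ : ∀ b ∈ (Sect2.regionOfSet (F.P K) Y).bonds, ‖A b‖ < t)
      (_ : ∀ q ∈ (Sect2.regionOfSet (F.P K) Y).dpairs, ‖grad ((F.P K).eta (K - n)) q.2.1 (fun y => A ⟨y, q.2.2⟩) q.1‖ < t)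
      (_ : ∀ b, A b - HV X b = A₁ b + A₂ b - A₃ b)
      (_ : Letters10On Y ((F.P K).eta (K - n)) t₁ A₁) (_ : Letters10On Y ((F.P K).eta (K - n)) t₂ A₂) (_ : Letters10On Y ((F.P K).eta (K - n)) t₃ A₃)
      {tD : ℝ} (_ : 2 * C * B₃ * (s + s) < tD),
      LocalGaugeSplitOn Y ((F.P K).eta (K - n)) t (t₁ + (t₂ + tD) + t₃) U := by
  obtain ⟨Mh₀, R₀, C, δ₀, δ₁, B₃, hC, hδ₀, hδ₁, hB₃, hmain⟩ := localGaugeSplitOn_of_gauge152_coarseShift_outerDefect_adm22_T4_nearTop F N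
  refine ⟨Mh₀, R₀, C, δ₀, δ₁, B₃, hC, hδ₀, hδ₁, hB₃, ?_⟩
  intro n K hk1 hk' Mh R a' hMha hMh hR hsize D hDk hAdm w hw Y hY HV hHV lam s hs0 hsout hunder X hX U u A A₁ A₂ A₃ t t₁ t₂ t₃ he hA hdA h159 h₁ h₂ h₃
    tD htD
  exact hmain n K hk1 hk' hMha hMh hR hsize D hDk hAdm w hw hY hHV (fun j y hy => siteAvgIter_levLift D lam hy) (add_nonneg hs0 hs0)
    (outerDefect_levLift_le_of_norm_le_under D lam hsout hunder) hX u he hA hdA h159 h₁ h₂ h₃ htD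

/-! ## §3  The sign-free record door, window over `Ω_{K−n−1}` -/

variable (F : T4Family) (N : ℕ) [NeZero N]

open scoped Classical in
/-- ★★★ **THE R0′ SPLIT CLAUSE AT THE RECORD's CENTRED SHEAR, SIGN-FREE FAMILY BINDER, WINDOW OF NEAR-TOP CELLS** — n07-w8's
`localGaugeSplitOn_of_gauge152_recordShear_dominated_adm22_T4` with `∀ x ∈ Y, D.InOm (K − n − 1) x`, every other binder VERBATIM (the family dominated by `‖log ĝ_j(y)⁻¹‖`, per-level
boxes `[lo_j, hi_j]` with letters `v_j, a_j` and a uniform `σ ≤ ½`, the three box-membership facts, `X` the coarse gradient of `λ`, S3's gauge with (152) letters `t`, the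
(159)-splitting with letters `t₁, t₂, t₃`): `LocalGaugeSplitOn Y η_{K−n} t (t₁ + (t₂ + t_∂) + t₃) U` for EVERY `t_∂ > 2CB₃·(4σ)` — the door the meet edition's FILE 2 instantiates at
print's (150) family. [cite: Balaban1985Variational, (144) p.300, (150)–(152) p.301, (157)–(159) pp.302–303, (161) p.303, (164)–(165) p.304, (168) p.304; Balaban1985Averaging, (85)–(88) p.31; Balaban1984PropagatorsII, (2.1)–(2.4) p.224, (2.35) p.228, (2.60) p.234, Cor. 2.8 (2.150)–(2.151) p.249; Balaban1984PropagatorsI, (1.18)–(1.20) p.20] -/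
theorem localGaugeSplitOn_of_gauge152_recordShear_dominated_adm22_T4_nearTop :
    ∃ (Mh₀ R₀ : ℕ) (C δ₀ δ₁ B₃ : ℝ), 0 ≤ C ∧ 0 < δ₀ ∧ 0 < δ₁ ∧ 0 < B₃ ∧
    ∀ (n K : ℕ) (_ : 1 ≤ K - n) (_ : K - n + 1 ≤ F.m + K) {Mh R a' : ℕ} (_ : Mh = F.L ^ a') (_ : Mh₀ ≤ Mh) (_ : R₀ ≤ R) (_ : a' + 3 ≤ F.m + n)
      (D : Domains (F.P K)) (_ : D.k = K - n) (_ : Adm22 D R (F.L * Mh))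
      (w : ℕ → PBond (F.P K) 0 → ℝ) (_ : IsLevWeight (F.P K) (K - n) D w)
      {Y : Set (Site (F.P K) 0)} (_ : ∀ x ∈ Y, D.InOm (K - n - 1) x)
      {HV : (BondIdx D → MatA N) →ₗ[ℂ] (PBond (F.P K) 0 → MatA N)}
      (_ : ∀ (B : BondIdx D → MatA N) (b : PBond (F.P K) 0), HV B b = ∑ c, ((flatH (F.P K) (K - n) D (Pi.single c 1) b : ℝ) : ℂ) • B c)
      -- the (r1)+(r4) row's Landau copy, its gauge, the per-level boxes and their per-level bond letters
      (uL : GaugeTransf (F.P K) 0 (SU N)) (U₁ : GaugeField (F.P K) 0 (SU N)) (lo hi : ℕ → (Fin (F.P K).d → ℤ)) (v a : ℕ → ℝ) {σ : ℝ}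
      (_ : ∀ j, 0 ≤ v j) (_ : ∀ j, 0 ≤ a j) (_ : σ ≤ 1 / 2)
      (_ : ∀ j ≤ K - n, ((∑ κ, (hi j κ - lo j κ).toNat : ℕ) : ℝ) * (v j + a j) ≤ σ)
      (_ : ∀ j ≤ K - n, ∀ c : PBond (F.P K) j, c.src ∈ (castSite '' Set.Icc (lo j) (hi j) : Set (Site (F.P K) j)) →
        c.tgt ∈ (castSite '' Set.Icc (lo j) (hi j) : Set (Site (F.P K) j)) → dist1 (Averaging.iter (avOfRecord F N K) j (gaugeAct uL U₁) c) ≤ v j)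
      (_ : ∀ j ≤ K - n, ∀ c : PBond (F.P K) j, c.src ∈ (castSite '' Set.Icc (lo j) (hi j) : Set (Site (F.P K) j)) →
        c.tgt ∈ (castSite '' Set.Icc (lo j) (hi j) : Set (Site (F.P K) j)) → dist1 (Averaging.iter (avOfRecord F N K) j U₁ c) ≤ a j)
      -- GEOMETRY (displayed)
      (_ : ∀ c : BondIdx D,
        (c.1.2.src ∉ D.Om c.1.1 → c.1.2.src ∈ (castSite '' Set.Icc (lo c.1.1) (hi c.1.1) : Set (Site (F.P K) c.1.1))) ∧
        (c.1.2.tgt ∉ D.Om c.1.1 → c.1.2.tgt ∈ (castSite '' Set.Icc (lo c.1.1) (hi c.1.1) : Set (Site (F.P K) c.1.1))))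
      (_ : ∀ (j : ℕ), 1 ≤ j → ∀ y : Site (F.P K) j, D.LamSite j y → y ∈ (castSite '' Set.Icc (lo j) (hi j) : Set (Site (F.P K) j)))
      (_ : ∀ (c : BondIdx D) (x : Site (F.P K) 0),
        (c.1.2.src ∉ D.Om c.1.1 ∧ iterBlockOf c.1.1 x = c.1.2.src) ∨ (c.1.2.tgt ∉ D.Om c.1.1 ∧ iterBlockOf c.1.1 x = c.1.2.tgt) →
        D.LamSite 0 x → x ∈ (castSite '' Set.Icc (lo 0) (hi 0) : Set (Site (F.P K) 0)))
      -- the shift family, DOMINATED by the (r1) letter family, and its datum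
      (lam : (j : ℕ) → Site (F.P K) j → MatA N)
      (_ : ∀ (j : ℕ) (y : Site (F.P K) j), ‖lam j y‖ ≤ ‖mlog (((((toMS uL j (castSite (lo j)))⁻¹ * toMS uL j y)⁻¹ : SU N)) : MatA N)‖)
      {X : BondIdx D → MatA N}
      (_ : ∀ c : BondIdx D, X c = LatticeFieldCalculus.grad (((F.P K).L : ℝ) ^ (K - n) / ((F.P K).L : ℝ) ^ (c.1.1 : ℕ)) (lam c.1.1) c.1.2)
      -- S3's gauge of `U` on the window and the (159)-splitting of `A − H_V X`
      {U : GaugeField (F.P K) 0 (SU N)} (u : GaugeTransf (F.P K) 0 (SU N)) {A A₁ A₂ A₃ : PBond (F.P K) 0 → MatA N} {t t₁ t₂ t₃ : ℝ}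
      (_ : ∀ b ∈ (Sect2.regionOfSet (F.P K) Y).bonds,
        gaugeU (fun x => ιSU N (u x)) (fun b' => ιSU N (U b')) b = expI ((F.P K).eta (K - n)) (A b))
      (_ : ∀ b ∈ (Sect2.regionOfSet (F.P K) Y).bonds, ‖A b‖ < t)
      (_ : ∀ q ∈ (Sect2.regionOfSet (F.P K) Y).dpairs, ‖grad ((F.P K).eta (K - n)) q.2.1 (fun y => A ⟨y, q.2.2⟩) q.1‖ < t)
      (_ : ∀ b, A b - HV X b = A₁ b + A₂ b - A₃ b)
      (_ : Letters10On Y ((F.P K).eta (K - n)) t₁ A₁) (_ : Letters10On Y ((F.P K).eta (K - n)) t₂ A₂) (_ : Letters10On Y ((F.P K).eta (K - n)) t₃ A₃)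
      {tD : ℝ} (_ : 2 * C * B₃ * (4 * σ) < tD),
      LocalGaugeSplitOn Y ((F.P K).eta (K - n)) t (t₁ + (t₂ + tD) + t₃) U := by
  obtain ⟨Mh₀, R₀, C, δ₀, δ₁, B₃, hC, hδ₀, hδ₁, hB₃, hmain⟩ := localGaugeSplitOn_of_gauge152_coarseShift_levLift_under_adm22_T4_nearTop F N
  refine ⟨Mh₀, R₀, C, δ₀, δ₁, B₃, hC, hδ₀, hδ₁, hB₃, ?_⟩
  intro n K hk1 hk' Mh R a' hMha hMh hR hsize D hDk hAdm w hw Y hY HV hHV uL U₁ lo hi v a σ hv0 ha0 hσ hDσ hv ha hboxO hboxS hbox0 lam hlam X hX U u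
    A A₁ A₂ A₃ t t₁ t₂ t₃ he hA hdA h159 h₁ h₂ h₃ tD htD
  -- the size of any dominated family on the level-`j` box, `j ≤ K − n`
  have hlamS : ∀ (j : ℕ) (_ : j ≤ K - n) (y : Site (F.P K) j), y ∈ (castSite '' Set.Icc (lo j) (hi j) : Set (Site (F.P K) j)) →
      ‖lam j y‖ ≤ 2 * σ := by
    intro j hj y hy
    have hjm : j ≤ (F.P K).m + (F.P K).K := (hj.trans hDk.symm.le).trans D.hk
    have hsmall : ((∑ κ, (hi j κ - lo j κ).toNat : ℕ) : ℝ) * (v j + a j) ≤ 1 / 2 := (hDσ j hj).trans hσ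
    exact (hlam j y).trans ((norm_mlog_centredShear_inv_le_box_record F N K uL U₁ hjm (hv0 j) (ha0 j) (hv j hj) (ha j hj) hsmall hy).trans
      (mul_le_mul_of_nonneg_left (hDσ j hj) (by norm_num)))
  have hσ0 : 0 ≤ σ := (mul_nonneg (Nat.cast_nonneg _) (add_nonneg (hv0 0) (ha0 0))).trans (hDσ 0 (Nat.zero_le _))
  have hs0 : 0 ≤ 2 * σ := by positivity
  have hsout : ∀ c : BondIdx D, (c.1.2.src ∉ D.Om c.1.1 → ‖lam c.1.1 c.1.2.src‖ ≤ 2 * σ) ∧ (c.1.2.tgt ∉ D.Om c.1.1 → ‖lam c.1.1 c.1.2.tgt‖ ≤ 2 * σ) :=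
    fun c => ⟨fun h => hlamS _ ((D.le_of_lamBond c.2).trans hDk.le) _ ((hboxO c).1 h),
      fun h => hlamS _ ((D.le_of_lamBond c.2).trans hDk.le) _ ((hboxO c).2 h)⟩
  have hunder : ∀ (c : BondIdx D) (x : Site (F.P K) 0),
      (c.1.2.src ∉ D.Om c.1.1 ∧ iterBlockOf c.1.1 x = c.1.2.src) ∨ (c.1.2.tgt ∉ D.Om c.1.1 ∧ iterBlockOf c.1.1 x = c.1.2.tgt) →
      ‖lam (levOf (fun i => {z : Site (F.P K) 0 | D.InOm i z}) D.k x) (iterBlockOf (levOf (fun i => {z : Site (F.P K) 0 | D.InOm i z}) D.k x) x)‖ ≤ 2 * σ := by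
    intro c x hx
    have hmem := iterBlockOf_levOf_mem_of_lamSite D (fun j => (castSite '' Set.Icc (lo j) (hi j) : Set (Site (F.P K) j))) x hboxS (hbox0 c x hx)
    exact hlamS _ ((D.le_of_lamSite (lamSite_levOf_inOm D x)).trans hDk.le) _ hmem
  have htD' : 2 * C * B₃ * (2 * σ + 2 * σ) < tD := by
    have : 2 * σ + 2 * σ = 4 * σ := by ring
    rw [this]; exact htD
  exact hmain n K hk1 hk' hMha hMh hR hsize D hDk hAdm w hw hY hHV lam hs0 hsout hunder hX u he hA hdA h159 h₁ h₂ h₃ htD'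

end Summit.QuantumFields.YangMills.BalabanUVNodes.N07SplitClauseRecordShearNearTop

end
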